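import Mathlib.NumberTheory.Primorial
import Literature.Computability.Complexity.SmallPrimesCRT
import HarnessLib

/-!
# Route PermanentDescent, crux `CollapseMakesPermanentEasy` (stmt-PneNP-16142), line `Sketch`
# (idea `errorless-islands`) — `stub_primes`: the prime supply for Chinese remaindering

Registered stub `stub_primes` of the skeleton `Cruxes/CollapseMakesPermanentEasy/Lines/Sketch.lean`:
for `n ≥ 256` the primes `p ∈ (n³, 8n³]` have product `≥ 4^{n³}` (the line recovers the permanent of an
`n × n` 0/1 matrix, a number `≤ n! < 2^{n²+1}`, from its residues modulo these primes).

Proof (pure number theory, `m := n³ ≥ 256³ = 2^24`). By Mathlib's `primorial_add`,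
`(8m)# = m# · ∏_{p ∈ (m, 8m], p prime} p`. The tree's Chebyshev prime supply
`SmallPrimes.two_pow_le_primorial` (`2^k ≤ N#` for `N ≥ 2^24`, `2k ≤ N`) at `N = 8m`, `k = 4m` gives
`(8m)# ≥ 2^{4m} = 4^m · 4^m`, and Mathlib's `primorial_le_four_pow` gives `m# ≤ 4^m`; hence
`4^m · 4^m ≤ 4^m · ∏ p` and the factor `4^m > 0` cancels.
-/

set_option linter.dupNamespace false -- `Summit.PneNP.PneNP.…`: summit = sub-problem name (D-0017 single-conjunct layout)

namespace Summit.PneNP.PneNP.Theorems.PermIsland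

open Literature.Computability.Complexity

/-- The primes in `(m, 8m]` as the half-open interval `[m+1, m+7m+1)` of `primorial_add`. [folklore] -/
theorem Ioc_eq_Ico_primorial (m : ℕ) : Finset.Ioc m (8 * m) = Finset.Ico (m + 1) (m + 7 * m + 1) := by
  ext x
  simp only [Finset.mem_Ioc, Finset.mem_Ico]
  omega

/-- `(8m)# = m# · ∏_{p ∈ (m, 8m], p prime} p` (Mathlib's `primorial_add`). [folklore] -/
theorem primorial_eight_mul (m : ℕ) :
    primorial (m + 7 * m) = primorial m * ∏ p ∈ (Finset.Ioc m (8 * m)).filter Nat.Prime, p := by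
  rw [Ioc_eq_Ico_primorial]
  exact primorial_add m (7 * m)

/-- **Prime supply on `(m, 8m]`**: for `m ≥ 2^24` the primes in `(m, 8m]` have product `≥ 4^m`
(Chebyshev: `(8m)# ≥ 2^{4m}` by the tree's `SmallPrimes.two_pow_le_primorial`, and `m# ≤ 4^m` by
Mathlib's `primorial_le_four_pow`). [folklore] -/
theorem four_pow_le_prod_primes_Ioc {m : ℕ} (hm : 2 ^ 24 ≤ m) :
    4 ^ m ≤ ∏ p ∈ (Finset.Ioc m (8 * m)).filter Nat.Prime, p := by
  have h16 : 2 ^ (4 * m) ≤ primorial (m + 7 * m) :=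
    SmallPrimes.two_pow_le_primorial (by omega) (by omega)
  have h44 : 4 ^ m * 4 ^ m = 2 ^ (4 * m) := by
    rw [← mul_pow, pow_mul]
    norm_num
  have key : 4 ^ m * 4 ^ m ≤ 4 ^ m * ∏ p ∈ (Finset.Ioc m (8 * m)).filter Nat.Prime, p :=
    calc 4 ^ m * 4 ^ m = 2 ^ (4 * m) := h44
      _ ≤ primorial (m + 7 * m) := h16
      _ = primorial m * ∏ p ∈ (Finset.Ioc m (8 * m)).filter Nat.Prime, p := primorial_eight_mul m
      _ ≤ 4 ^ m * ∏ p ∈ (Finset.Ioc m (8 * m)).filter Nat.Prime, p :=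
          Nat.mul_le_mul_right _ (primorial_le_four_pow m)
  exact le_of_mul_le_mul_left key (by positivity)

/-- **Stub N (prime supply for Chinese remaindering).** The primes in `(n³, 8n³]` have product
`≥ 4^{n³}` once `n ≥ 256` (then `n³ ≥ 256³ = 2^24`, where the tree's Chebyshev bound starts).
[cite: AroraBarakCC2009, §8.6.2] -/
theorem stub_primes :
    ∀ n : ℕ, 256 ≤ n → 4 ^ (n ^ 3) ≤ ∏ p ∈ (Finset.Ioc (n ^ 3) (8 * n ^ 3)).filter Nat.Prime, p := by
  intro n hn
  have hm : 2 ^ 24 ≤ n ^ 3 :=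
    calc 2 ^ 24 = 256 ^ 3 := by norm_num
      _ ≤ n ^ 3 := Nat.pow_le_pow_left hn 3
  exact four_pow_le_prod_primes_Ioc hm

end Summit.PneNP.PneNP.Theorems.PermIsland
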